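import Mathlib
import HarnessLib

/-!
# Level-set surrogate of the perimeter for smooth functions on `ℝ³`, and the co-area inequality

Analysis/FunctionSpaces support file for the proof of Maz'ya's trace inequality
`Literature.Analysis.FunctionSpaces.MazyaTraceD` (V. G. Maz'ja, *Sobolev Spaces* (1985), §1.4.2, Theorem 2
with Theorem 1, `q = 1`, `n = 3`), file `MazyaTraceInequality.lean`; the discharge
`MazyaTraceD_holds` is assembled in `MazyaTraceInequalityHolds.lean` from three pieces that all speak
the language fixed HERE.

Maz'ya's proof runs through the co-area formula `∫ ‖∇u‖ = ∫₀^∞ s(∂{u > t}) dt` and Gustin's boxing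
inequality for sets of finite perimeter.  Neither the co-area formula nor sets of finite perimeter are in
Mathlib, and they are not needed: the whole argument can be run on the smooth function itself, with the
perimeter of the level set `{u > t}` inside a region `U` replaced by the **level-set perimeter surrogate**

  `levelPerimeter u t U = liminf_{k → ∞} ∫⁻_U η_k'(u x - t) ‖Du x‖ dx`,

where `η_k(s) = levelStep k s = Real.smoothTransition (k s - 1)` is a fixed smooth monotone step
(`= 0` for `s ≤ 1/k`, `= 1` for `s ≥ 2/k`), so that `η_k (u - t)` is a smooth approximation of the
indicator of `{u > t}` from inside and `∫⁻_U η_k'(u - t) ‖Du‖ = ∫⁻_U ‖D(η_k ∘ (u - t))‖` is the total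
variation of that approximation inside `U` (for the genuine perimeter one would have
`P({u>t}; U) ≤ levelPerimeter u t U`, with equality for a.e. `t` by the co-area formula; neither fact is
used or proved).

Contents:
* `levelStep`, its elementary calculus (`levelStep_eq_zero`, `levelStep_eq_one`, `deriv_levelStep_nonneg`,
  the chain rule `enorm_fderiv_levelStep_comp`, the pointwise limit `tendsto_levelStep`);
* `levelPerimeter`, monotone in `U` (`levelPerimeter_mono`) and superadditive over countable disjoint
  measurable families (`tsum_levelPerimeter_le`, Fatou for the counting measure), measurable in `t`;
* the **co-area inequality for the surrogate** (`lintegral_levelPerimeter_le`):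
  `∫⁻ t, levelPerimeter u t U ≤ ∫⁻ x in U, ‖Du x‖` for `u ∈ C¹` — Tonelli, the one-dimensional identity
  `∫ η_k'(c - t) dt = 1` (`lintegral_deriv_levelStep_sub`), and Fatou's lemma.  This is the "easy half" of
  the co-area formula and is all the trace inequality needs.

The relative isoperimetric inequality on balls (`min(|{u>t} ∩ B|, |B ∖ {u>t}|) ≤ c r · levelPerimeter u t B`,
from the `p = 1` Poincaré inequality on balls) and the boxing inequality
(`∫_{u>t} g ≤ c K · levelPerimeter u t ℝ³` under `BallGrowthTwo g K`) are separate files by other hands.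

## References

* V. G. Maz'ja, *Sobolev Spaces*, Springer Series in Soviet Mathematics (1985), §1.2.4 (co-area formula),
  §1.4.2 Theorems 1–2.
* H. Federer, *Curvature measures*, Trans. AMS 93 (1959) (co-area formula) — historical.
-/

noncomputable section

open MeasureTheory Set Function Filter Metric
open scoped ENNReal NNReal Topology

namespace Literature.Analysis.FunctionSpaces

/-! ### The smooth steps `η_k` -/

/-- The smooth step at scale `1/k`: `levelStep k s = Real.smoothTransition (k s - 1)`, a `C^∞` monotone
function with values in `[0, 1]`, `= 0` for `s ≤ 1/k` and `= 1` for `s ≥ 2/k`; `levelStep k (u x - t)` is a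
smooth inner approximation of the indicator of the superlevel set `{u > t}`. [cite: Mazja1985, §1.2.4 Theorem (co-area formula) — smooth level-set surrogate] -/
def levelStep (k : ℕ) (s : ℝ) : ℝ := Real.smoothTransition ((k : ℝ) * s - 1)

/-- `levelStep k` is smooth. [cite: Mazja1985, §1.2.4 Theorem (co-area formula) — smooth level-set surrogate] -/
theorem levelStep_contDiff (k : ℕ) {n : ℕ∞} : ContDiff ℝ n (levelStep k) :=
  Real.smoothTransition.contDiff.comp ((contDiff_const.mul contDiff_id).sub contDiff_const)

/-- `levelStep k` is differentiable. [cite: Mazja1985, §1.2.4 Theorem (co-area formula) — smooth level-set surrogate] -/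
theorem levelStep_differentiable (k : ℕ) : Differentiable ℝ (levelStep k) :=
  (levelStep_contDiff k (n := 1)).differentiable one_ne_zero

/-- `levelStep k` is continuous. [cite: Mazja1985, §1.2.4 Theorem (co-area formula) — smooth level-set surrogate] -/
theorem levelStep_continuous (k : ℕ) : Continuous (levelStep k) :=
  (levelStep_contDiff k (n := 0)).continuous

/-- `0 ≤ levelStep k s`. [cite: Mazja1985, §1.2.4 Theorem (co-area formula) — smooth level-set surrogate] -/
theorem levelStep_nonneg (k : ℕ) (s : ℝ) : 0 ≤ levelStep k s := Real.smoothTransition.nonneg _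

/-- `levelStep k s ≤ 1`. [cite: Mazja1985, §1.2.4 Theorem (co-area formula) — smooth level-set surrogate] -/
theorem levelStep_le_one (k : ℕ) (s : ℝ) : levelStep k s ≤ 1 := Real.smoothTransition.le_one _

/-- `levelStep k` is monotone. [cite: Mazja1985, §1.2.4 Theorem (co-area formula) — smooth level-set surrogate] -/
theorem levelStep_monotone (k : ℕ) : Monotone (levelStep k) := fun a b hab =>
  Real.smoothTransition.monotone (by
    have hk : (0 : ℝ) ≤ k := Nat.cast_nonneg k
    nlinarith [mul_le_mul_of_nonneg_left hab hk])

/-- `levelStep k s = 0` for `k s ≤ 1` (in particular for `s ≤ 1/k`, and for all `s ≤ 0`). [cite: Mazja1985, §1.2.4 Theorem (co-area formula) — smooth level-set surrogate] -/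
theorem levelStep_eq_zero {k : ℕ} {s : ℝ} (hs : (k : ℝ) * s ≤ 1) : levelStep k s = 0 :=
  Real.smoothTransition.zero_of_nonpos (by linarith)

/-- `levelStep k s = 0` for `s ≤ 0`. [cite: Mazja1985, §1.2.4 Theorem (co-area formula) — smooth level-set surrogate] -/
theorem levelStep_eq_zero_of_nonpos (k : ℕ) {s : ℝ} (hs : s ≤ 0) : levelStep k s = 0 :=
  levelStep_eq_zero (by nlinarith [Nat.cast_nonneg (α := ℝ) k])

/-- `levelStep k s = 1` for `2 ≤ k s` (i.e. `s ≥ 2/k`, `k ≥ 1`). [cite: Mazja1985, §1.2.4 Theorem (co-area formula) — smooth level-set surrogate] -/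
theorem levelStep_eq_one {k : ℕ} {s : ℝ} (hs : 2 ≤ (k : ℝ) * s) : levelStep k s = 1 :=
  Real.smoothTransition.one_of_one_le (by linarith)

/-- The derivative of the smooth step: `(levelStep k)' s = k · smoothTransition' (k s - 1)`. [cite: Mazja1985, §1.2.4 Theorem (co-area formula) — smooth level-set surrogate] -/
theorem hasDerivAt_levelStep (k : ℕ) (s : ℝ) :
    HasDerivAt (levelStep k) ((k : ℝ) * deriv Real.smoothTransition ((k : ℝ) * s - 1)) s := by
  have h1 : HasDerivAt (fun s : ℝ => (k : ℝ) * s - 1) (k : ℝ) s := by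
    simpa using ((hasDerivAt_id s).const_mul (k : ℝ)).sub_const 1
  have h2 : HasDerivAt Real.smoothTransition (deriv Real.smoothTransition ((k : ℝ) * s - 1))
      ((k : ℝ) * s - 1) :=
    ((Real.smoothTransition.contDiff (n := 1)).differentiable one_ne_zero _).hasDerivAt
  have := h2.comp s h1
  rwa [mul_comm] at this

/-- Formula for `deriv (levelStep k)`. [cite: Mazja1985, §1.2.4 Theorem (co-area formula) — smooth level-set surrogate] -/
theorem deriv_levelStep (k : ℕ) (s : ℝ) :
    deriv (levelStep k) s = (k : ℝ) * deriv Real.smoothTransition ((k : ℝ) * s - 1) :=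
  (hasDerivAt_levelStep k s).deriv

/-- `0 ≤ (levelStep k)'`. [cite: Mazja1985, §1.2.4 Theorem (co-area formula) — smooth level-set surrogate] -/
theorem deriv_levelStep_nonneg (k : ℕ) (s : ℝ) : 0 ≤ deriv (levelStep k) s := by
  rw [deriv_levelStep]
  -- `smoothTransition` is monotone, so its derivative is non-negative (cf. the same remark in
  -- `Literature.NumberTheory.Sieve.GreenTao2008.deriv_smoothTransition_nonneg`, not imported here)
  exact mul_nonneg (Nat.cast_nonneg k)
    (((Real.smoothTransition.contDiff (n := 1)).differentiable one_ne_zero _).hasDerivAt.nonneg_of_monotone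
      Real.smoothTransition.monotone)

/-- `deriv (levelStep k)` is continuous. [cite: Mazja1985, §1.2.4 Theorem (co-area formula) — smooth level-set surrogate] -/
theorem continuous_deriv_levelStep (k : ℕ) : Continuous (deriv (levelStep k)) :=
  (levelStep_contDiff k (n := 1)).continuous_deriv le_rfl

/-- The derivative of `levelStep k` vanishes where `k s < 1` (there `levelStep k` is locally `0`). [cite: Mazja1985, §1.2.4 Theorem (co-area formula) — smooth level-set surrogate] -/
theorem deriv_levelStep_eq_zero_of_lt {k : ℕ} {s : ℝ} (hs : (k : ℝ) * s < 1) : deriv (levelStep k) s = 0 := by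
  have h : levelStep k =ᶠ[𝓝 s] fun _ => (0 : ℝ) := by
    have ho : IsOpen {s : ℝ | (k : ℝ) * s < 1} :=
      isOpen_lt (continuous_const.mul continuous_id) continuous_const
    filter_upwards [ho.mem_nhds hs] with s' hs'
    exact levelStep_eq_zero (le_of_lt hs')
  rw [h.deriv_eq, deriv_const]

/-- The derivative of `levelStep k` vanishes where `2 < k s` (there `levelStep k` is locally `1`). [cite: Mazja1985, §1.2.4 Theorem (co-area formula) — smooth level-set surrogate] -/
theorem deriv_levelStep_eq_zero_of_gt {k : ℕ} {s : ℝ} (hs : 2 < (k : ℝ) * s) : deriv (levelStep k) s = 0 := by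
  have h : levelStep k =ᶠ[𝓝 s] fun _ => (1 : ℝ) := by
    have ho : IsOpen {s : ℝ | 2 < (k : ℝ) * s} :=
      isOpen_lt continuous_const (continuous_const.mul continuous_id)
    filter_upwards [ho.mem_nhds hs] with s' hs'
    exact levelStep_eq_one (le_of_lt hs')
  rw [h.deriv_eq, deriv_const]

/-- Pointwise limit of the steps: `levelStep k s → 𝟙_{(0, ∞)}(s)` as `k → ∞`. [cite: Mazja1985, §1.2.4 Theorem (co-area formula) — smooth level-set surrogate] -/
theorem tendsto_levelStep (s : ℝ) :
    Tendsto (fun k : ℕ => levelStep k s) atTop (𝓝 ((Ioi (0 : ℝ)).indicator 1 s)) := by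
  rcases le_or_gt s 0 with hs | hs
  · have h0 : (Ioi (0 : ℝ)).indicator (1 : ℝ → ℝ) s = 0 := indicator_of_notMem (by simpa using hs) _
    rw [h0]
    refine tendsto_const_nhds.congr fun k => (levelStep_eq_zero_of_nonpos k hs).symm
  · have h1 : (Ioi (0 : ℝ)).indicator (1 : ℝ → ℝ) s = 1 := by
      rw [indicator_of_mem (by simpa using hs)]; rfl
    rw [h1]
    refine tendsto_const_nhds.congr' ?_
    obtain ⟨N, hN⟩ := exists_nat_ge (2 / s)
    filter_upwards [eventually_ge_atTop N] with k hk
    refine (levelStep_eq_one ?_).symm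
    have hk' : (2 / s : ℝ) ≤ k := hN.trans (by exact_mod_cast hk)
    rw [div_le_iff₀ hs] at hk'
    linarith

/-- For `u x - t` in place of `s`: `levelStep k (u x - t) → 𝟙_{{u > t}}(x)`. [cite: Mazja1985, §1.2.4 Theorem (co-area formula) — smooth level-set surrogate] -/
theorem tendsto_levelStep_sub {α : Type*} (u : α → ℝ) (t : ℝ) (x : α) :
    Tendsto (fun k : ℕ => levelStep k (u x - t)) atTop (𝓝 ({y | t < u y}.indicator 1 x)) := by
  have h := tendsto_levelStep (u x - t)
  have : (Ioi (0 : ℝ)).indicator (1 : ℝ → ℝ) (u x - t) = {y | t < u y}.indicator 1 x := by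
    by_cases hx : t < u x
    · rw [indicator_of_mem (show u x - t ∈ Ioi (0:ℝ) by simpa [sub_pos] using hx),
        indicator_of_mem (show x ∈ {y | t < u y} from hx)]
      rfl
    · rw [indicator_of_notMem (show u x - t ∉ Ioi (0:ℝ) by simpa [sub_pos] using hx),
        indicator_of_notMem (show x ∉ {y | t < u y} from hx)]
  rwa [this] at h

/-! ### Composition with a `C¹` function -/

section Comp

variable {E : Type*} [NormedAddCommGroup E] [NormedSpace ℝ E]

/-- Chain rule: the Fréchet derivative of `x ↦ levelStep k (u x - t)`. [cite: Mazja1985, §1.2.4 Theorem (co-area formula) — smooth level-set surrogate] -/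
theorem hasFDerivAt_levelStep_comp (k : ℕ) {u : E → ℝ} {x : E} {u' : E →L[ℝ] ℝ}
    (hu : HasFDerivAt u u' x) (t : ℝ) :
    HasFDerivAt (fun y => levelStep k (u y - t)) (deriv (levelStep k) (u x - t) • u') x := by
  have h1 : HasFDerivAt (fun y => u y - t) u' x := hu.sub_const t
  have h2 : HasDerivAt (levelStep k) (deriv (levelStep k) (u x - t)) (u x - t) :=
    ((levelStep_differentiable k) (u x - t)).hasDerivAt
  have h3 := h2.comp_hasFDerivAt x h1
  exact h3

/-- Chain rule for `fderiv`: `D(levelStep k ∘ (u - t)) x = (levelStep k)'(u x - t) • Du x`. [cite: Mazja1985, §1.2.4 Theorem (co-area formula) — smooth level-set surrogate] -/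
theorem fderiv_levelStep_comp (k : ℕ) {u : E → ℝ} {x : E} (hu : DifferentiableAt ℝ u x) (t : ℝ) :
    fderiv ℝ (fun y => levelStep k (u y - t)) x = deriv (levelStep k) (u x - t) • fderiv ℝ u x :=
  (hasFDerivAt_levelStep_comp k hu.hasFDerivAt t).fderiv

/-- `‖D(levelStep k ∘ (u - t)) x‖ₑ = (levelStep k)'(u x - t) · ‖Du x‖ₑ` (the derivative of the step is
non-negative). [cite: Mazja1985, §1.2.4 Theorem (co-area formula) — smooth level-set surrogate] -/
theorem enorm_fderiv_levelStep_comp (k : ℕ) {u : E → ℝ} {x : E} (hu : DifferentiableAt ℝ u x) (t : ℝ) :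
    ‖fderiv ℝ (fun y => levelStep k (u y - t)) x‖ₑ =
      ENNReal.ofReal (deriv (levelStep k) (u x - t)) * ‖fderiv ℝ u x‖ₑ := by
  rw [fderiv_levelStep_comp k hu t, enorm_smul, Real.enorm_eq_ofReal (deriv_levelStep_nonneg k _)]

/-- The composition `levelStep k ∘ (u - t)` is `C^n` when `u` is. [cite: Mazja1985, §1.2.4 Theorem (co-area formula) — smooth level-set surrogate] -/
theorem contDiff_levelStep_comp (k : ℕ) {u : E → ℝ} {n : ℕ∞} (hu : ContDiff ℝ n u) (t : ℝ) :
    ContDiff ℝ n fun y => levelStep k (u y - t) :=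
  (levelStep_contDiff k).comp (hu.sub contDiff_const)

end Comp

/-! ### The one-dimensional identity `∫ η_k'(c - t) dt ≤ 1` -/

/-- `∫⁻ t, (levelStep k)'(c - t) dt ≤ 1`: the total variation of the monotone step is at most `1`
(`= 1` for `k ≥ 1`, `= 0` for `k = 0`). [cite: Mazja1985, §1.2.4 Theorem (co-area formula), easy half] -/
theorem lintegral_deriv_levelStep_sub_le (k : ℕ) (c : ℝ) :
    ∫⁻ t, ENNReal.ofReal (deriv (levelStep k) (c - t)) ≤ 1 := by
  rcases Nat.eq_zero_or_pos k with rfl | hk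
  · -- `levelStep 0` is constant
    have : ∀ s, deriv (levelStep 0) s = 0 := fun s =>
      deriv_levelStep_eq_zero_of_lt (by simp)
    simp [this]
  have hk0 : (0 : ℝ) < k := by exact_mod_cast hk
  -- `φ t = 1 - levelStep k (c - t)` is an antiderivative of the integrand, increasing from `0` to `1`
  set φ : ℝ → ℝ := fun t => 1 - levelStep k (c - t) with hφ
  have hderiv : ∀ t, HasDerivAt φ (deriv (levelStep k) (c - t)) t := by
    intro t
    have h1 : HasDerivAt (fun t : ℝ => c - t) (-1) t := by simpa using (hasDerivAt_id t).const_sub c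
    have h2 : HasDerivAt (fun t : ℝ => levelStep k (c - t)) (deriv (levelStep k) (c - t) * -1) t :=
      ((levelStep_differentiable k) (c - t)).hasDerivAt.comp t h1
    exact (h2.const_sub 1).congr_deriv (by ring)
  have hcont : Continuous fun t => deriv (levelStep k) (c - t) :=
    (continuous_deriv_levelStep k).comp (continuous_const.sub continuous_id)
  -- the integrand vanishes outside `[c - 2/k, c - 1/k]`, hence has compact support
  have hsupp : Function.support (fun t => deriv (levelStep k) (c - t)) ⊆ Icc (c - 2 / k) (c - 1 / k) := by
    intro t ht
    rw [Function.mem_support] at ht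
    by_contra h
    rw [mem_Icc, not_and_or, not_le, not_le] at h
    rcases h with h | h
    · exact ht (deriv_levelStep_eq_zero_of_gt (by
        have : 2 / (k : ℝ) < c - t := by linarith
        rw [div_lt_iff₀ hk0] at this; linarith))
    · exact ht (deriv_levelStep_eq_zero_of_lt (by
        have : c - t < 1 / (k : ℝ) := by linarith
        rw [lt_div_iff₀ hk0] at this; linarith))
  have hcs : HasCompactSupport fun t => deriv (levelStep k) (c - t) :=
    HasCompactSupport.of_support_subset_isCompact isCompact_Icc hsupp
  have hint : Integrable fun t => deriv (levelStep k) (c - t) := hcont.integrable_of_hasCompactSupport hcs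
  -- limits of `φ` at `±∞`: eventually constant
  have hbot : Tendsto φ atBot (𝓝 0) := by
    refine tendsto_const_nhds.congr' ?_
    filter_upwards [eventually_le_atBot (c - 2 / k)] with t ht
    have : levelStep k (c - t) = 1 := levelStep_eq_one (by
      have h' : 2 / (k : ℝ) ≤ c - t := by linarith
      rw [div_le_iff₀ hk0] at h'; linarith)
    simp [hφ, this]
  have htop : Tendsto φ atTop (𝓝 1) := by
    refine tendsto_const_nhds.congr' ?_
    filter_upwards [eventually_ge_atTop (c - 1 / k)] with t ht
    have : levelStep k (c - t) = 0 := levelStep_eq_zero (by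
      have h' : c - t ≤ 1 / (k : ℝ) := by linarith
      rw [le_div_iff₀ hk0] at h'; linarith)
    simp [hφ, this]
  have hFTC : ∫ t, deriv (levelStep k) (c - t) = 1 - 0 :=
    integral_of_hasDerivAt_of_tendsto hderiv hint hbot htop
  rw [← ofReal_integral_eq_lintegral_ofReal hint
    (Eventually.of_forall fun t => deriv_levelStep_nonneg k _), hFTC]
  simp

/-! ### The level-set perimeter surrogate -/

/-- **Level-set perimeter surrogate.** For `u : ℝ³ → ℝ`, a level `t` and a region `U`,
`levelPerimeter u t U = liminf_{k→∞} ∫⁻_{U} (levelStep k)'(u x - t) · ‖Du x‖ dx`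
(`= liminf_k ∫⁻_U ‖D(levelStep k ∘ (u - t))‖` for `u ∈ C¹`, by `enorm_fderiv_levelStep_comp`): the
lower limit of the total variations inside `U` of the smooth inner approximations `levelStep k (u - t)` of
the indicator of `{u > t}`.  It stands in for the perimeter of `{u > t}` inside `U` in the BV-free proof
of Maz'ya's trace inequality (`MazyaTraceD`). [cite: Mazja1985, §1.2.4 Theorem (co-area formula) — smooth level-set surrogate] -/
def levelPerimeter (u : EuclideanSpace ℝ (Fin 3) → ℝ) (t : ℝ) (U : Set (EuclideanSpace ℝ (Fin 3))) : ℝ≥0∞ :=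
  Filter.liminf (fun k : ℕ => ∫⁻ x in U, ENNReal.ofReal (deriv (levelStep k) (u x - t)) * ‖fderiv ℝ u x‖ₑ)
    Filter.atTop

/-- Unfolding lemma for `levelPerimeter`. [cite: Mazja1985, §1.2.4 Theorem (co-area formula) — smooth level-set surrogate] -/
theorem levelPerimeter_def (u : EuclideanSpace ℝ (Fin 3) → ℝ) (t : ℝ) (U : Set (EuclideanSpace ℝ (Fin 3))) :
    levelPerimeter u t U = Filter.liminf
      (fun k : ℕ => ∫⁻ x in U, ENNReal.ofReal (deriv (levelStep k) (u x - t)) * ‖fderiv ℝ u x‖ₑ)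
      Filter.atTop := rfl

/-- For `u ∈ C¹` the surrogate is the lower limit of `∫⁻_U ‖D(levelStep k ∘ (u - t))‖`. [cite: Mazja1985, §1.2.4 Theorem (co-area formula) — smooth level-set surrogate] -/
theorem levelPerimeter_eq_liminf_lintegral_fderiv_comp {u : EuclideanSpace ℝ (Fin 3) → ℝ} (hu : Differentiable ℝ u) (t : ℝ)
    (U : Set (EuclideanSpace ℝ (Fin 3))) :
    levelPerimeter u t U =
      Filter.liminf (fun k : ℕ => ∫⁻ x in U, ‖fderiv ℝ (fun y => levelStep k (u y - t)) x‖ₑ)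
        Filter.atTop := by
  rw [levelPerimeter_def]
  congr 1
  funext k
  refine lintegral_congr fun x => ?_
  rw [enorm_fderiv_levelStep_comp k (hu x) t]

/-- `levelPerimeter u t U` is monotone in `U`. [cite: Mazja1985, §1.2.4 Theorem (co-area formula) — smooth level-set surrogate] -/
theorem levelPerimeter_mono (u : EuclideanSpace ℝ (Fin 3) → ℝ) (t : ℝ) {U V : Set (EuclideanSpace ℝ (Fin 3))} (h : U ⊆ V) :
    levelPerimeter u t U ≤ levelPerimeter u t V :=
  Filter.liminf_le_liminf (Eventually.of_forall fun _ => lintegral_mono_set h)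

/-- **Fatou for series**: `∑' i, liminf_k a i k ≤ liminf_k ∑' i, a i k` in `ℝ≥0∞` (Fatou's lemma for the
counting measure). [folklore] -/
private theorem tsum_liminf_le_liminf_tsum {ι : Type*} [Countable ι] (a : ι → ℕ → ℝ≥0∞) :
    ∑' i, Filter.liminf (fun k => a i k) atTop ≤ Filter.liminf (fun k => ∑' i, a i k) atTop := by
  letI : MeasurableSpace ι := ⊤
  haveI : MeasurableSingletonClass ι := ⟨fun _ => trivial⟩
  have h := lintegral_liminf_le (μ := Measure.count) (u := atTop) (f := fun k i => a i k)
    (fun _ => measurable_from_top)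
  simpa only [lintegral_count] using h

/-- **Superadditivity of the surrogate over disjoint regions**: for a countable pairwise disjoint family
of measurable sets `U i`, `∑' i, levelPerimeter u t (U i) ≤ levelPerimeter u t (⋃ i, U i)`. [cite: Mazja1985, §1.2.4 Theorem (co-area formula) — smooth level-set surrogate] -/
theorem tsum_levelPerimeter_le {ι : Type*} [Countable ι] (u : EuclideanSpace ℝ (Fin 3) → ℝ) (t : ℝ) {U : ι → Set (EuclideanSpace ℝ (Fin 3))}
    (hm : ∀ i, MeasurableSet (U i)) (hd : Pairwise (Disjoint on U)) :
    ∑' i, levelPerimeter u t (U i) ≤ levelPerimeter u t (⋃ i, U i) := by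
  simp only [levelPerimeter_def]
  refine (tsum_liminf_le_liminf_tsum _).trans (le_of_eq ?_)
  congr 1
  funext k
  rw [lintegral_iUnion hm hd]

/-- Superadditivity, version for a family of sets indexed by a countable SET with pairwise disjoint
members (the shape delivered by Vitali's covering lemma). [cite: Mazja1985, §1.2.4 Theorem (co-area formula) — smooth level-set surrogate] -/
theorem tsum_levelPerimeter_le_of_countable {ι : Type*} (u : EuclideanSpace ℝ (Fin 3) → ℝ) (t : ℝ) {s : Set ι}
    (hs : s.Countable) {U : ι → Set (EuclideanSpace ℝ (Fin 3))} (hm : ∀ i ∈ s, MeasurableSet (U i))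
    (hd : s.PairwiseDisjoint U) (V : Set (EuclideanSpace ℝ (Fin 3))) (hV : ∀ i ∈ s, U i ⊆ V) :
    ∑' i : s, levelPerimeter u t (U i) ≤ levelPerimeter u t V := by
  haveI : Countable s := hs.to_subtype
  have hd' : Pairwise (Disjoint on fun i : s => U i) := by
    intro i j hij
    exact hd i.2 j.2 (fun h => hij (Subtype.ext h))
  calc ∑' i : s, levelPerimeter u t (U i)
      ≤ levelPerimeter u t (⋃ i : s, U i) := tsum_levelPerimeter_le u t (fun i : s => hm i i.2) hd'
    _ ≤ levelPerimeter u t V := levelPerimeter_mono u t (iUnion_subset fun i => hV i i.2)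

/-! ### Measurability in the level and the co-area inequality -/

/-- Joint continuity of the integrand `(t, x) ↦ (levelStep k)'(u x - t) · ‖Du x‖ₑ` gives its joint
measurability. [cite: Mazja1985, §1.2.4 Theorem (co-area formula) — smooth level-set surrogate] -/
theorem measurable_levelIntegrand {u : EuclideanSpace ℝ (Fin 3) → ℝ} (hu : ContDiff ℝ 1 u) (k : ℕ) :
    Measurable fun p : ℝ × EuclideanSpace ℝ (Fin 3) =>
      ENNReal.ofReal (deriv (levelStep k) (u p.2 - p.1)) * ‖fderiv ℝ u p.2‖ₑ := by
  have hc1 : Continuous fun p : ℝ × EuclideanSpace ℝ (Fin 3) => deriv (levelStep k) (u p.2 - p.1) :=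
    (continuous_deriv_levelStep k).comp
      ((hu.continuous.comp continuous_snd).sub continuous_fst)
  have hc2 : Continuous fun p : ℝ × EuclideanSpace ℝ (Fin 3) => fderiv ℝ u p.2 :=
    (hu.continuous_fderiv one_ne_zero).comp continuous_snd
  exact (ENNReal.measurable_ofReal.comp hc1.measurable).mul hc2.measurable.enorm

/-- For each `k`, the inner integral `t ↦ ∫⁻_U (levelStep k)'(u - t) ‖Du‖` is measurable in the level
`t` (Tonelli). [cite: Mazja1985, §1.2.4 Theorem (co-area formula) — smooth level-set surrogate] -/
theorem measurable_lintegral_levelIntegrand {u : EuclideanSpace ℝ (Fin 3) → ℝ} (hu : ContDiff ℝ 1 u) (k : ℕ) (U : Set (EuclideanSpace ℝ (Fin 3))) :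
    Measurable fun t : ℝ =>
      ∫⁻ x in U, ENNReal.ofReal (deriv (levelStep k) (u x - t)) * ‖fderiv ℝ u x‖ₑ :=
  (measurable_levelIntegrand hu k).lintegral_prod_right' (ν := volume.restrict U)

/-- `t ↦ levelPerimeter u t U` is measurable for `u ∈ C¹`. [cite: Mazja1985, §1.2.4 Theorem (co-area formula) — smooth level-set surrogate] -/
theorem measurable_levelPerimeter {u : EuclideanSpace ℝ (Fin 3) → ℝ} (hu : ContDiff ℝ 1 u) (U : Set (EuclideanSpace ℝ (Fin 3))) :
    Measurable fun t : ℝ => levelPerimeter u t U :=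
  Measurable.liminf fun k => measurable_lintegral_levelIntegrand hu k U

/-- For each `k`: `∫⁻ t, ∫⁻_U (levelStep k)'(u x - t) ‖Du x‖ dx dt ≤ ∫⁻_U ‖Du‖` (Tonelli and
`∫ η_k' ≤ 1`). [cite: Mazja1985, §1.2.4 Theorem (co-area formula), easy half] -/
theorem lintegral_lintegral_levelIntegrand_le {u : EuclideanSpace ℝ (Fin 3) → ℝ} (hu : ContDiff ℝ 1 u) (k : ℕ) (U : Set (EuclideanSpace ℝ (Fin 3))) :
    ∫⁻ t, ∫⁻ x in U, ENNReal.ofReal (deriv (levelStep k) (u x - t)) * ‖fderiv ℝ u x‖ₑ ≤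
      ∫⁻ x in U, ‖fderiv ℝ u x‖ₑ := by
  have hmeas : AEMeasurable
      (uncurry fun (t : ℝ) (x : EuclideanSpace ℝ (Fin 3)) =>
        ENNReal.ofReal (deriv (levelStep k) (u x - t)) * ‖fderiv ℝ u x‖ₑ)
      ((volume : Measure ℝ).prod (volume.restrict U)) :=
    (measurable_levelIntegrand hu k).aemeasurable
  rw [lintegral_lintegral_swap hmeas]
  refine lintegral_mono fun x => ?_
  have hm : Measurable fun t : ℝ => ENNReal.ofReal (deriv (levelStep k) (u x - t)) :=
    ENNReal.measurable_ofReal.comp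
      ((continuous_deriv_levelStep k).comp (continuous_const.sub continuous_id)).measurable
  rw [lintegral_mul_const _ hm]
  calc (∫⁻ t, ENNReal.ofReal (deriv (levelStep k) (u x - t))) * ‖fderiv ℝ u x‖ₑ
      ≤ 1 * ‖fderiv ℝ u x‖ₑ := by
        gcongr
        exact lintegral_deriv_levelStep_sub_le k (u x)
    _ = ‖fderiv ℝ u x‖ₑ := one_mul _

/-- **Co-area inequality for the level-set perimeter surrogate.** For `u ∈ C¹(ℝ³)` and any
region `U`, `∫⁻ t, levelPerimeter u t U dt ≤ ∫⁻ x in U, ‖Du x‖ dx`: Fatou's lemma in `t` and, for each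
`k`, Tonelli with `∫ (levelStep k)'(u x - t) dt ≤ 1`.  (The easy half of the co-area formula
`∫₀^∞ P({u > t}; U) dt = ∫_U ‖Du‖`, Maz'ja 1985 §1.2.4, in surrogate form.) [cite: Mazja1985, §1.2.4 Theorem (co-area formula), easy half] -/
theorem lintegral_levelPerimeter_le {u : EuclideanSpace ℝ (Fin 3) → ℝ} (hu : ContDiff ℝ 1 u) (U : Set (EuclideanSpace ℝ (Fin 3))) :
    ∫⁻ t, levelPerimeter u t U ≤ ∫⁻ x in U, ‖fderiv ℝ u x‖ₑ := by
  simp only [levelPerimeter_def]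
  refine (lintegral_liminf_le fun k => measurable_lintegral_levelIntegrand hu k U).trans ?_
  refine liminf_le_of_frequently_le' (Frequently.of_forall fun k => ?_)
  exact lintegral_lintegral_levelIntegrand_le hu k U

/-- The co-area inequality over positive levels only and `U = ℝ³` (the form used by the trace
inequality): `∫⁻_{t > 0} levelPerimeter u t ℝ³ ≤ ∫⁻ ‖Du‖`. [cite: Mazja1985, §1.2.4 Theorem (co-area formula), easy half] -/
theorem lintegral_Ioi_levelPerimeter_univ_le {u : EuclideanSpace ℝ (Fin 3) → ℝ} (hu : ContDiff ℝ 1 u) :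
    ∫⁻ t in Ioi 0, levelPerimeter u t univ ≤ ∫⁻ x, ‖fderiv ℝ u x‖ₑ := by
  calc ∫⁻ t in Ioi 0, levelPerimeter u t univ ≤ ∫⁻ t, levelPerimeter u t univ :=
        setLIntegral_le_lintegral _ _
    _ ≤ ∫⁻ x in univ, ‖fderiv ℝ u x‖ₑ := lintegral_levelPerimeter_le hu univ
    _ = ∫⁻ x, ‖fderiv ℝ u x‖ₑ := by rw [Measure.restrict_univ]

end Literature.Analysis.FunctionSpaces

end
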